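import Summits.PneNP.PneNP.Theorems.ConvexRankGatesConvexGateBlindExactLiftingTriangleLineCover

/-!
# Triangle instance — the unit level EXACTLY: `rk₊(M_t − J) = t³` by a fooling set

Support file for crux `ConvexGateBlind` (stmt-PneNP-10680), open stub `stub_exactLifting` (prover seat 0, session 28,
memo ANALYSIS13). `M_t[x,w] = monoCount x w ∈ {1,3}`; at the top of the window `ε = 1` the shifted matrix
`M_t − J = 2·[w monochromatic under x]` is a `0/2` matrix. Known in the tree: `t³ ≤ 108·r` for every `r`-term
non-negative factorisation (`triangle_window`, rectangle/density argument). Here the EXACT value: the `t³` entries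
`(x_w, w)`, with the asymmetric colouring `x_w` = (colour-`true` classes `{w₀}`, `{w₁}`, `{d : d ≤ w₂}`), form a
FOOLING SET — `w` is monochromatic under `x_w`, and for `w ≠ w'` not both "`w'` mono under `x_w`" and "`w` mono under
`x_{w'}`" (`fool`) — so every non-negative factorisation of `M_t − J` (indexed by any finite type) has at least `t³`
terms (`card_ge_of_unit_fact`; registered `triangle_unit_level_exact`), matching the `t³` points: `f_t(1) = t³` exactly.
-/

set_option linter.dupNamespace false -- `Summit.PneNP.PneNP.…`: summit = sub-problem (D-0017)

namespace Summit.PneNP.PneNP.Theorems.XorDoor.TriLine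

open Finset

variable {t : ℕ}

/-- `w` is monochromatic under its own fooling colouring `x_w` (colour-`true` classes `{w₀}`, `{w₁}`, `{d ≤ w₂}`;
written inline to keep the file definition-free) -/
lemma isMono_foolCol_self (w : Tri t) :
    IsMono ((fun a => decide (a = w.1), fun b => decide (b = w.2.1), fun d => decide (d ≤ w.2.2)) : Col t)
      w.1 w.2.1 w.2.2 := by
  simp [IsMono]

/-- **the fooling property**: for `w ≠ w'`, `w'` mono under `x_w` and `w` mono under `x_{w'}` cannot both hold -/
lemma fool {w w' : Tri t} (hne : w ≠ w')
    (h1 : IsMono ((fun a => decide (a = w.1), fun b => decide (b = w.2.1), fun d => decide (d ≤ w.2.2)) : Col t)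
      w'.1 w'.2.1 w'.2.2)
    (h2 : IsMono ((fun a => decide (a = w'.1), fun b => decide (b = w'.2.1), fun d => decide (d ≤ w'.2.2)) : Col t)
      w.1 w.2.1 w.2.2) : False := by
  obtain ⟨a, b, d⟩ := w
  obtain ⟨a', b', d'⟩ := w'
  simp only [IsMono, decide_eq_decide] at h1 h2
  obtain ⟨h1a, h1b⟩ := h1
  obtain ⟨h2a, h2b⟩ := h2
  by_cases ha : a' = a
  · subst ha
    have hb : b' = b := by simpa using h1a
    subst hb
    have hd1 : d' ≤ d := by simpa using h1b
    have hd2 : d ≤ d' := by simpa using h2b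
    exact hne (by rw [le_antisymm hd2 hd1])
  · have ha' : ¬ a = a' := fun h => ha h.symm
    have hd1 : ¬ d' ≤ d := by simpa [ha] using h1b
    have hd2 : ¬ d ≤ d' := by simpa [ha'] using h2b
    omega

/-- **The unit level exactly.** Every real factorisation `∑_i u_i(x) v_i(w) = M_t[x,w] − 1` with NON-NEGATIVE factors,
indexed by a finite type `ι`, has `t³ ≤ #ι`. -/
theorem card_ge_of_unit_fact {ι : Type} [Fintype ι] (u : ι → Col t → ℝ) (v : ι → Tri t → ℝ)
    (hu : ∀ i x, 0 ≤ u i x) (hv : ∀ i w, 0 ≤ v i w)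
    (hfact : ∀ x w, ∑ i, u i x * v i w = (monoCount x w : ℝ) - 1) : t ^ 3 ≤ Fintype.card ι := by
  classical
  -- the fooling colourings
  let foolCol : Tri t → Col t := fun w =>
    (fun a => decide (a = w.1), fun b => decide (b = w.2.1), fun d => decide (d ≤ w.2.2))
  -- every fooling entry is covered by some term
  have hcov : ∀ w : Tri t, ∃ i, u i (foolCol w) ≠ 0 ∧ v i w ≠ 0 := by
    intro w
    have h3 : (monoCount (foolCol w) w : ℝ) - 1 = 2 := by
      obtain ⟨a, b, d⟩ := w
      rw [monoCount_of_isMono (isMono_foolCol_self (a, b, d))]; norm_num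
    have hne : ∑ i, u i (foolCol w) * v i w ≠ 0 := by rw [hfact, h3]; norm_num
    obtain ⟨i, -, hi⟩ := exists_ne_zero_of_sum_ne_zero hne
    exact ⟨i, left_ne_zero_of_mul hi, right_ne_zero_of_mul hi⟩
  choose f hf using hcov
  -- the covering map is injective
  have hinj : Function.Injective f := by
    intro w w' hww
    by_contra hne
    have hpos : ∀ {y : Col t} {z : Tri t} (i : ι), u i y ≠ 0 → v i z ≠ 0 → IsMono y z.1 z.2.1 z.2.2 := by
      intro y z i hy hz
      have hlt : 0 < u i y * v i z :=
        mul_pos (lt_of_le_of_ne (hu i y) hy.symm) (lt_of_le_of_ne (hv i z) hz.symm)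
      have hle : u i y * v i z ≤ ∑ j, u j y * v j z :=
        single_le_sum (f := fun j => u j y * v j z) (fun j _ => mul_nonneg (hu j y) (hv j z)) (mem_univ i)
      rw [hfact] at hle
      by_contra hm
      obtain ⟨a, b, d⟩ := z
      have : (monoCount y (a, b, d) : ℝ) = 1 := by exact_mod_cast monoCount_of_not_isMono hm
      rw [this] at hle
      linarith
    have h1 : IsMono (foolCol w) w'.1 w'.2.1 w'.2.2 := hpos (f w) (hf w).1 (by rw [hww]; exact (hf w').2)
    have h2 : IsMono (foolCol w') w.1 w.2.1 w.2.2 := hpos (f w') (hf w').1 (by rw [← hww]; exact (hf w).2)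
    exact fool hne h1 h2
  have := Fintype.card_le_of_injective f hinj
  simpa [Fintype.card_prod, Fintype.card_fin, pow_succ, mul_assoc] using this

/-- **The unit level of the triangle instance, exactly** (registered sub-goal `triangle_unit_level_exact` of
stmt-PneNP-10680, verbatim signature): every factorisation of `M_t − J` into `#ι` non-negative rank-one terms has
`t³ ≤ #ι` (and `t³` terms suffice: the points), i.e. `rk₊(M_t − J) = t³`. -/
theorem triangle_unit_level_exact : ∀ (t : ℕ) (ι : Type) [Fintype ι] (u : ι → (Fin t → Bool) × (Fin t → Bool) ×
    (Fin t → Bool) → ℝ) (v : ι → Fin t × Fin t × Fin t → ℝ), (∀ i x, 0 ≤ u i x) → (∀ i w, 0 ≤ v i w) → (∀ x w, ∑ i,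
    u i x * v i w = ((if x.1 w.1 = x.2.1 w.2.1 then 1 else 0) + (if x.1 w.1 = x.2.2 w.2.2 then 1 else 0) + (if x.2.1
    w.2.1 = x.2.2 w.2.2 then 1 else 0) : ℝ) - 1) → t ^ 3 ≤ Fintype.card ι := by
  intro t ι _ u v hu hv hfact
  exact card_ge_of_unit_fact u v hu hv fun x w => by
    rw [hfact x w]; simp only [monoCount]; push_cast; ring

end Summit.PneNP.PneNP.Theorems.XorDoor.TriLine
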